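import Literature.AnabelianGeometry.EtaleTheta.Discharge.Sec3RealSpanTateTowerNormalForm
import Literature.AnabelianGeometry.EtaleTheta.Discharge.Sec3Thm37TateTowerR
import Literature.AnabelianGeometry.EtaleTheta.Discharge.Sec3Cor38OfGaloisCoveringConnectedR
import HarnessLib

/-!
# [EtTh] Prop. 3.4 (ii), the `Λ = ℝ` effective-locus clause `hE`, PROVED at the model of record (the Tate tower);
# Thm. 3.7 (i)–(iv) and Cor. 3.8 (i)(ii) at monoid type `Λ = ℝ` there with NO binder

S. Mochizuki, *The étale theta function and its Frobenioid-theoretic manifestations*, Publ. RIMS **45** (2009), Prop. 3.4 (ii)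
p.74 ("a log-meromorphic function with effective divisor is constant") read at the monoid type `Λ = ℝ` of Def. 3.6 (i) p.76
(`B₀^ℝ := ℝ·Φ₀^birat`, `F₀^ℝ := ℝ·Φ₀^cnst`) [cite: MochizukiEtTh2009, Prop 3.4 (ii) p.74]; Thm. 3.7 p.79, Cor. 3.8 p.80.

abc-iut cell, layer L2, seat abc-iut-L2-d2 (gen 5), L2-lead R482 «hE@TateTower» (census A2, GAP G-w5d130-1), part 2 of 2
(toolkit: `Sec3RealSpanTateTowerNormalForm.lean`).  PROOF-ONLY.  The clause `hE` — "an element of `ℝ·Φ₀^birat(Y)` which is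
EFFECTIVE (the class of an element of `Φ₀(Y)^rlf`) lies in `ℝ·Φ₀^cnst(Y)`" — was the ONLY remaining binder of [EtTh] Thm. 3.7
(i)–(iv) `Λ = ℝ` (`TateTowerFrd.thm37_temperedFrobenioidR`, p453493) and of Cor. 3.8 (i)(ii) `Λ = ℝ`
(`TateTowerFrd.cor38_i_ii_temperedFrobenioidR`, p450744) at the model of record `TateTowerFrd.temperedFrobenioidR` (abc-iut-w6-d048).

* `TateTowerFrd.effRealSpan_dm` — `hE` HOLDS at every connected covering `Y` of the Tate tower: write an element of
  `ℝ·Φ₀^birat(Y)` as `a • ι[Σ_j F_j] · β • ι(div₀ b₀)` (normal form of part 1, `b₀` a function with a `U`-part at the base point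
  `s₀` if there is one); if it is the class of an element of `Φ₀(Y)^rlf`, every degree "multiplicity at `F_j`" is `≥ 0` on it,
  i.e. `a + β(c₀ + k₀ j) ≥ 0` for all `j ∈ ℤ` (`b₀(s₀) = ϖ^{c₀} U^{k₀}`, `k₀ ≠ 0`), so `β = 0` and the element is
  `a • ι(div₀ ϖ) ∈ ℝ·Φ₀^cnst(Y)`; if no function has a `U`-part, `ℝ·Φ₀^birat(Y) = ℝ·ι[Σ F_j]` directly.
* COROLLARIES with NO binder at the model of record: `TateTowerFrd.thm37_temperedFrobenioidR_unconditional` ([EtTh] Thm. 3.7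
  (i)–(iv), `Λ = ℝ`), `TateTowerFrd.cor38_i_ii_temperedFrobenioidR_unconditional` (Cor. 3.8 (i) ∧ (ii) AS TYPED, `Λ = ℝ`) and
  `TateTowerFrd.cor38_i_ii_conclusion_temperedFrobenioidR_unconditional` (their conclusions, the one-object base being Div-slim).

HONEST LABEL: elementary verification at CONSTRUCTED data (the Tate tower skeleton of Def. 3.1/3.3); refereed pre-IUT material;
nothing here bears on [IUTchIII] Cor. 3.12; no side taken; typed ≠ proved — here proved, no binder left at this model.
-/

noncomputable section

namespace Literature.AnabelianGeometry.EtaleTheta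

open CategoryTheory Opposite Function NNReal Literature.AlgebraicGeometry.Frobenioids LogDivisorModel
  LogDivisorModel.GaloisAction

/-- If `A + B j ≥ 0` for every integer `j`, then `B = 0`. [folklore] -/
private theorem eq_zero_of_forall_int_nonneg {A B : ℝ} (h : ∀ j : ℤ, 0 ≤ A + B * j) : B = 0 := by
  by_contra hB
  rcases lt_or_gt_of_ne hB with hB' | hB'
  · obtain ⟨j, hj⟩ := exists_int_gt (-A / B)
    have h1 : B * (j : ℝ) < B * (-A / B) := mul_lt_mul_of_neg_left hj hB'
    have h3 := h j
    rw [mul_div_cancel₀ (-A) hB] at h1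
    linarith
  · obtain ⟨j, hj⟩ := exists_int_lt (-A / B)
    have h1 : B * (j : ℝ) < B * (-A / B) := mul_lt_mul_of_pos_left hj hB'
    have h3 := h j
    rw [mul_div_cancel₀ (-A) hB] at h1
    linarith

namespace TateTowerFrd

open LogDivisorModel.TateTower RealifiedDivisorMonoids

/-- **The `Λ = ℝ` effective-locus clause `hE` of [EtTh] Prop. 3.4 (ii) (census A2, GAP G-w5d130-1) HOLDS at the model of
record**: at every connected covering `Y` of the Tate tower, an element of `ℝ·Φ₀^birat(Y)` which is the class of an element of
`Φ₀(Y)^rlf` lies in `ℝ·Φ₀^cnst(Y)` — a log-meromorphic "function" `a•[Σ F_j] + β•div₀(b₀)` with EFFECTIVE real divisor has no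
`U`-part, since its multiplicity `a + β(c₀ + k₀ j)` at `F_j` is `≥ 0` for every `j ∈ ℤ`. [cite: MochizukiEtTh2009, Prop 3.4 (ii) p.74] -/
theorem effRealSpan_dm (Y : D₀)
    (b : Algebra.GrothendieckGroup ((RealifiedDivisorMonoids.realDataWeak dm hpf).rlf.obj (op Y)))
    (x : (hpf (op Y)).weak.Rlf)
    (hb : b ∈ ((RealifiedDivisorMonoids.realDataWeak dm hpf).realSpan dm.biratGp).carrier Y)
    (hbx : b = Algebra.GrothendieckGroup.of x) :
    b ∈ ((RealifiedDivisorMonoids.realDataWeak dm hpf).realSpan dm.cnstGp).carrier Y := by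
  classical
  obtain ⟨⟨s₀⟩, htrans⟩ := Y.property
  -- `[Σ_j F_j] = div₀(ϖ) ∈ Φ₀^cnst(Y)`
  have hG₁ : Algebra.GrothendieckGroup.of ((⟨_, constDIV_one_mem_phiZero Y.obj⟩ : TateTower.action.phiZero Y.obj) :
      dm.Φ₀.obj (op Y)) ∈ dm.cnstGp.carrier Y := by
    refine dm.mem_cnstGp_of_mem_cnst Y ⟨⟨_, const_mem_bZero Y.obj 1⟩, fun _ => ofAdd_const_mem_const 1, ?_⟩
    have h := divZero_eq_zpow_of_forall_eq Y.obj ⟨_, constDIV_one_mem_phiZero Y.obj⟩ (fun _ => rfl)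
      ⟨_, const_mem_bZero Y.obj 1⟩ 1 (fun _ => rfl)
    rw [zpow_one] at h
    exact h
  by_cases hU : ∃ b' : TateTower.action.bZero Y.obj, (Multiplicative.toAdd (b'.1 s₀)).2 ≠ 0
  · -- some function has a `U`-part at `s₀`: take it as the reference function `b₀`
    obtain ⟨b₀, hk₀⟩ := hU
    obtain ⟨a, β, hξ⟩ := exists_eq_rsmul_mul_rsmul Y s₀ b₀ (c₀ := (Multiplicative.toAdd (b₀.1 s₀)).1)
      (k₀ := (Multiplicative.toAdd (b₀.1 s₀)).2) rfl (fun _ _ => hk₀) hb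
    -- effectivity kills the `U`-part: `β k₀ = 0`
    have hβ : β * (Multiplicative.toAdd (b₀.1 s₀)).2 = 0 := by
      refine eq_zero_of_forall_int_nonneg (A := a + β * (Multiplicative.toAdd (b₀.1 s₀)).1) fun j => ?_
      obtain ⟨κ, hκ⟩ := exists_rlfHom_val_eq Y s₀ j
      have h0 : 0 ≤ Multiplicative.toAdd (Algebra.GrothendieckGroup.lift (PrimeCoord.toRealMul.comp κ) b) := by
        rw [hbx]
        exact RlfDegreeWeak.toAdd_lift_of_nonneg κ x
      have h1 : ((Multiplicative.toAdd (κ ((hpf (op Y)).weak.toRealification (Perfection.of _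
          ((⟨_, constDIV_one_mem_phiZero Y.obj⟩ : TateTower.action.phiZero Y.obj))))) : ℝ≥0) : ℝ) = 1 := by
        rw [hκ]
        exact Int.cast_one
      rw [hξ, map_mul, toAdd_mul, toAdd_lift_rsmul, toAdd_lift_rsmul, toAdd_lift_toRlfGp_divZero Y s₀ j κ hκ b₀,
        realDataWeak_toRlfGp_of, toAdd_lift_of_rlf, h1] at h0
      linarith
    have hβ0 : β = 0 := (mul_eq_zero.mp hβ).resolve_right (Int.cast_ne_zero.mpr hk₀)
    rw [hξ, hβ0, (realDataWeak dm hpf).rsmul_zero, mul_one]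
    exact Subgroup.subset_closure ⟨a, _, hG₁, rfl⟩
  · -- no function has a `U`-part: reference function `1`, and `ι(div₀ 1) = 1`
    obtain ⟨a, β, hξ⟩ :=
      exists_eq_rsmul_mul_rsmul Y s₀ 1 (c₀ := 0) (k₀ := 0) rfl (fun b' hb' => (hU ⟨b', hb'⟩).elim) hb
    have h1 : (realDataWeak dm hpf).toRlfGp Y (TateTower.action.divZero Y.obj 1) = 1 := by
      have h := map_one (TateTower.action.divZeroHom Y.obj)
      rw [TateTower.action.divZeroHom_apply] at h
      rw [h]
      exact map_one ((realDataWeak dm hpf).toRlfGp Y)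
    rw [hξ, h1, map_one, mul_one]
    exact Subgroup.subset_closure ⟨a, _, hG₁, rfl⟩

variable (R S R' S' : ((Discrete PUnit.{1})ᵒᵖ ⥤ CommMonCat.{0}) → Prop)

/-- **[EtTh] Theorem 3.7 (i)–(iv), monoid type `Λ = ℝ`, at the MODEL OF RECORD with NO binder**: `thm37_temperedFrobenioidR`
(p453493; abc-iut-w6-d061's `thm37_ofRankOnePointR_of_inputs`) with its only hypothesis `hE` DISCHARGED by `effRealSpan_dm`.
[cite: MochizukiEtTh2009, Thm 3.7 p.79] -/
theorem thm37_temperedFrobenioidR_unconditional :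
    (PreFrobenioid.IsOfType (PreFrobenioid.IsUnitTrivial (temperedFrobenioidR R S).toElem) ∧
      PreFrobenioid.IsOfIsotropicType (temperedFrobenioidR R S).toElem ∧
      PreFrobenioid.IsOfModelType (temperedFrobenioidR R S).toElem
        ((temperedFrobenioidR R S).isFrobenioid_treeCatVocab_of_isMonoidOn
          (TemperedFrobenioid.isMonoidOn_ratFnFunctor_ofRankOnePointR TateTower.cuspLaws rankOnePoint hpf
            R S))
        (PreFrobenioid.hasBiratSquares_of_isFrobenioid
          ((temperedFrobenioidR R S).isFrobenioid_treeCatVocab_of_isMonoidOn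
            (TemperedFrobenioid.isMonoidOn_ratFnFunctor_ofRankOnePointR TateTower.cuspLaws rankOnePoint hpf
              R S))) ∧
      PreFrobenioidData.IsOfBiratFrobeniusNormalizedType
        (PreFrobenioid.biratData
          ((temperedFrobenioidR R S).isFrobenioid_treeCatVocab_of_isMonoidOn
            (TemperedFrobenioid.isMonoidOn_ratFnFunctor_ofRankOnePointR TateTower.cuspLaws rankOnePoint hpf
              R S))
          (PreFrobenioid.hasBiratSquares_of_isFrobenioid
            ((temperedFrobenioidR R S).isFrobenioid_treeCatVocab_of_isMonoidOn
              (TemperedFrobenioid.isMonoidOn_ratFnFunctor_ofRankOnePointR TateTower.cuspLaws rankOnePoint hpf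
                R S)))) ∧
      PreFrobenioid.IsOfType (PreFrobenioid.IsSubQuasiFrobeniusTrivial (temperedFrobenioidR R S).toElem) ∧
      ¬ PreFrobenioid.IsOfType (PreFrobenioid.IsGroupLikeObj (temperedFrobenioidR R S).toElem)) ∧
    ((ModelFrobenioid.data (temperedFrobenioidR R S).divisorMonoid (temperedFrobenioidR R S).ratFnFunctor
        (temperedFrobenioidR R S).divBNatTrans).IsOfStandardType ∧
      (PreFrobenioidData.ofFunctor (temperedFrobenioidR R S).divisorMonoid
          (temperedFrobenioidR R S).toElem).IsOfRationallyStandardType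
        (PreFrobenioid.rsParams
          ((temperedFrobenioidR R S).isFrobenioid_treeCatVocab_of_isMonoidOn
            (TemperedFrobenioid.isMonoidOn_ratFnFunctor_ofRankOnePointR TateTower.cuspLaws rankOnePoint hpf
              R S))
          fun a 𝔭 => PrimarySupp a 𝔭)) ∧
    (∀ X : (temperedFrobenioidR R S).category,
      FrobenioidFacade.AutActionFactorsThrough ((temperedFrobenioidR R S).base ⋙ (Functor.const D₀).obj (Literature.AnabelianGeometry.SemiGraphs.CosetCat.top : Literature.AnabelianGeometry.SemiGraphs.CosetCat PUnit.{1})) (temperedFrobenioidR R S).toElem X) ∧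
    (temperedFrobenioidR R S).Thm37_iv :=
  thm37_temperedFrobenioidR R S effRealSpan_dm

/-- **[EtTh] Cor. 3.8 (i) ∧ (ii) AS TYPED, monoid type `Λ = ℝ`, at the MODEL OF RECORD with NO binder beyond `h`**:
`cor38_i_ii_temperedFrobenioidR` (p450744) with `hE` DISCHARGED by `effRealSpan_dm`. [cite: MochizukiEtTh2009, Cor 3.8 p.80] -/
theorem cor38_i_ii_temperedFrobenioidR_unconditional
    (h : Cor38Hyp (temperedFrobenioidR R S) (temperedFrobenioidR R' S')) :
    Literature.AnabelianGeometry.EtaleTheta.Cor38_i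
        (fun E _ => Literature.AlgebraicGeometry.Frobenioids.IsFrobeniusSlim E) h ∧
      Literature.AnabelianGeometry.EtaleTheta.Cor38_ii
        (fun E _ Φ => ∀ (B : E) (α : Aut (Over.forget B)),
          (∀ (B' : Over B) (x : Φ.obj (op B'.left)),
            Literature.AlgebraicGeometry.Frobenioids.pull Φ (α.hom.app B') x = x) → α = 1) h :=
  cor38_i_ii_temperedFrobenioidR R S R' S' h effRealSpan_dm

/-- **The CONCLUSIONS of Cor. 3.8 (i) and (ii), monoid type `Λ = ℝ`, at the model of record, for every `h`** (the one-object
base is slim and Div-slim). [cite: MochizukiEtTh2009, Cor 3.8 p.81] -/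
theorem cor38_i_ii_conclusion_temperedFrobenioidR_unconditional
    (h : Cor38Hyp (temperedFrobenioidR R S) (temperedFrobenioidR R' S')) :
    PreservesBaseFieldTheoretic h ∧
      ∃ Ψbs : (temperedFrobenioidR R S).hullCategory ≌ (temperedFrobenioidR R' S').hullCategory,
        Nonempty ((temperedFrobenioidR R S).hull ⋙ h.Ψ.functor ≅ Ψbs.functor ⋙ (temperedFrobenioidR R' S').hull) :=
  (cor38_i_ii_temperedFrobenioidR_unconditional R S R' S' h).2 (Toy.isDivSlim45iv_discretePUnit _)
    (Toy.isDivSlim45iv_discretePUnit _)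

end TateTowerFrd

end Literature.AnabelianGeometry.EtaleTheta

end
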